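import Summits.ValiantsHypothesis.ValiantsHypothesis.Theorems.KPlusLogSqLawTropicalStaticMountainDefs

/-!
# Route «KPlusLogSqLaw» — the static family MOUNTAIN, part 1: basic values, presence, splitting sums

HONEST FRAMING.  Helper chain of the object-search cell `pub-symmetroid` (seat val-sym-lift-p1 g5, 2026-08-27) toward
the cruxes `WeakLifting` (ledger item `stmt-ValiantsHypothesis-19561`) / `TropicalB` (`stmt-ValiantsHypothesis-19771`) of
route `KPlusLogSqLaw`, in the vocabulary of `…CensusTropicalKLaw` / `…CensusTropicalKLawStatic` (`TropRootLawAt`,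
`TropRootLawAtStatic`, `IsStatic`, `IsDominant`, `termSign`, `tropWeight`).  It is a statement of FINITE TROPICAL
COMBINATORICS (an explicit dominance design per format `(m, 3)` and its chain); nothing here asserts or bears on `TropicalB`,
`WeakLifting`, `Lifting`, `KPlusLogSqLaw`, the cell's real census or registers (DoorA26 / DoorA34), `MatrixDescartes`
(`stmt-ValiantsHypothesis-18050`) or `VP ≠ VNP`.

Proved here (sorry-free; design in `…StaticMountainDefs`): size facts of the scale `Q = 2(m+1)²`; the values of `cls`,
`dd`, `val`, `sgn` by position; the design's signs lie in `{−1,0,1}` (`ee_natAbs`) and it is STATIC (`isStatic_ee`);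
presence forces the sign-rule class and forbids long ascents off column `0` (`cls_of_ee_ne_zero`,
`unitAsc_of_sgn_ne_zero`); the values of the mountain map (`mtn_val`, `mf_*`); five-piece splitting of sums/products over
`Fin (n+1)` along the blocks of a mountain (`sum_split5`, `prod_split5`) and the telescope `∑_(a<t) Q^a (Q−1) = Q^t − 1`
(`geom`).
-/

-- `Summit.ValiantsHypothesis.ValiantsHypothesis.…` repeats a component by the D-0017 layout
-- (single-conjunct summit), which the `dupNamespace` linter flags; the name is mandated.
set_option linter.dupNamespace false
set_option autoImplicit false

namespace Summit.ValiantsHypothesis.ValiantsHypothesis.Theorems.LacunarySymmetroidMatrixDescartes.TropicalCensus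

open Summit.ValiantsHypothesis.ValiantsHypothesis.Theorems.MatrixDescartes.Negative
open scoped BigOperators
open Finset

namespace Mountain

variable (n : ℕ)

/-- unfolding `Q`. -/
theorem Q_def : Q n = 2 * ((n : ℤ) + 2) ^ 2 := rfl

/-- `Q ≥ 8`. -/
theorem eight_le_Q : 8 ≤ Q n := by
  unfold Q
  have h0 : (0 : ℤ) ≤ (n : ℤ) := Nat.cast_nonneg n
  nlinarith [h0]

/-- `Q > 0`. -/
theorem Q_pos : 0 < Q n := by linarith [eight_le_Q n]

/-- `Q ≥ 1`. -/
theorem one_le_Q : 1 ≤ Q n := by linarith [eight_le_Q n]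

/-- powers of `Q` are positive. -/
theorem Q_pow_pos (k : ℕ) : 0 < Q n ^ k := pow_pos (Q_pos n) k

/-- powers of `Q` are monotone in the exponent. -/
theorem Q_pow_mono {a b : ℕ} (h : a ≤ b) : Q n ^ a ≤ Q n ^ b := pow_le_pow_right₀ (one_le_Q n) h

/-- `Q^(k+1) = Q^k·Q`. -/
theorem Q_pow_succ (k : ℕ) : Q n ^ (k + 1) = Q n ^ k * Q n := pow_succ _ _

/-- `C(y,2) ≤ (n+1)²` for `y ≤ n + 1`. -/
theorem choose_two_le (y : ℕ) (hy : y ≤ n + 1) : ((y.choose 2 : ℕ) : ℤ) ≤ ((n : ℤ) + 1) ^ 2 := by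
  have h1 : y.choose 2 ≤ y ^ 2 := Nat.choose_le_pow y 2
  have h2 : y ^ 2 ≤ (n + 1) ^ 2 := Nat.pow_le_pow_left hy 2
  have h3 : ((y.choose 2 : ℕ) : ℤ) ≤ (((n + 1) ^ 2 : ℕ) : ℤ) := by exact_mod_cast h1.trans h2
  simpa using h3

/-- the key size condition: `C(y,2) + (n+1) + 3 ≤ Q` for `y ≤ n + 1`. -/
theorem choose_two_add_le_Q (y : ℕ) (hy : y ≤ n + 1) : ((y.choose 2 : ℕ) : ℤ) + (n + 1) + 3 ≤ Q n := by
  have := choose_two_le n y hy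
  unfold Q; nlinarith [sq_nonneg (n : ℤ)]

/-- class of a diagonal entry. -/
theorem cls_diag (a : Fin (n + 1)) : cls n a a = 0 := by unfold cls; rw [if_pos rfl]

/-- class of a lower entry. -/
theorem cls_lower (a b : Fin (n + 1)) (h : (b : ℕ) < (a : ℕ)) : cls n a b = 1 := by
  unfold cls
  rw [if_neg (fun hab => by rw [hab] at h; exact lt_irrefl _ h), if_pos h]

/-- class of an upper entry. -/
theorem cls_upper (a b : Fin (n + 1)) (h : (a : ℕ) < (b : ℕ)) : cls n a b = 2 := by
  unfold cls
  rw [if_neg (fun hab => by rw [hab] at h; exact lt_irrefl _ h), if_neg (by omega)]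

/-- the three exponents: `d 0 = 0`, `d 1 = 1`, `d 2 = m + 2`. -/
theorem dd_vals : dd n 0 = 0 ∧ dd n 1 = 1 ∧ dd n 2 = n + 3 := ⟨rfl, rfl, rfl⟩

/-- diagonal entries cost `0`. -/
theorem val_diag (a : Fin (n + 1)) : val n a a = 0 := by unfold val; rw [if_pos rfl]

/-- the column-`0` entry `(a,0)` costs `Q^a − Q`. -/
theorem val_col0 (a b : Fin (n + 1)) (h : (b : ℕ) < (a : ℕ)) (hb : (b : ℕ) = 0) :
    val n a b = Q n ^ (a : ℕ) - Q n := by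
  unfold val
  rw [if_neg (fun hab => by rw [hab] at h; exact lt_irrefl _ h), if_pos h, if_pos hb]

/-- lower entries off column `0` cost `0`. -/
theorem val_lower (a b : Fin (n + 1)) (h : (b : ℕ) < (a : ℕ)) (hb : (b : ℕ) ≠ 0) : val n a b = 0 := by
  unfold val
  rw [if_neg (fun hab => by rw [hab] at h; exact lt_irrefl _ h), if_pos h, if_neg hb]

/-- cost of an upper entry. -/
theorem val_upper (a b : Fin (n + 1)) (h : (a : ℕ) < (b : ℕ)) :
    val n a b = Q n ^ (a : ℕ) * (Q n - 1) + Q n ^ ((a : ℕ) + 1) * ((((b : ℕ) - (a : ℕ)).choose 2 : ℕ) : ℤ) := by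
  unfold val
  rw [if_neg (fun hab => by rw [hab] at h; exact lt_irrefl _ h), if_neg (by omega)]

/-- every valuation is nonnegative. -/
theorem val_nonneg (a b : Fin (n + 1)) : 0 ≤ val n a b := by
  unfold val
  split_ifs with h1 h2 h3
  · exact le_rfl
  · have ha : 1 ≤ (a : ℕ) := by omega
    have := Q_pow_mono n ha
    rw [pow_one] at this
    linarith
  · exact le_rfl
  · have h4 := Q_pow_pos n (a : ℕ)
    have h5 := Q_pow_pos n ((a : ℕ) + 1)
    have h6 := one_le_Q n
    positivity

/-- an upper entry landing in row `a` costs at least `Q^a (Q − 1)`. -/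
theorem val_upper_ge (a b : Fin (n + 1)) (h : (a : ℕ) < (b : ℕ)) : Q n ^ (a : ℕ) * (Q n - 1) ≤ val n a b := by
  rw [val_upper n a b h]
  have h5 := Q_pow_pos n ((a : ℕ) + 1)
  have : (0 : ℤ) ≤ ((((b : ℕ) - (a : ℕ)).choose 2 : ℕ) : ℤ) := by positivity
  nlinarith

/-- diagonal entries are present with sign `+1`. -/
theorem sgn_diag (a : Fin (n + 1)) : sgn n a a = 1 := by unfold sgn; rw [if_pos rfl]

/-- column-`0` entries carry `csign`. -/
theorem sgn_col0 (a b : Fin (n + 1)) (h : (b : ℕ) < (a : ℕ)) (hb : (b : ℕ) = 0) : sgn n a b = csign n a := by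
  unfold sgn
  rw [if_neg (fun hab => by rw [hab] at h; exact lt_irrefl _ h), if_pos h, if_pos hb]

/-- unit ascents are present with sign `+1`. -/
theorem sgn_unitAsc (a b : Fin (n + 1)) (h : (b : ℕ) < (a : ℕ)) (hb : (b : ℕ) ≠ 0) (hab : (a : ℕ) = (b : ℕ) + 1) :
    sgn n a b = 1 := by
  unfold sgn
  rw [if_neg (fun hab => by rw [hab] at h; exact lt_irrefl _ h), if_pos h, if_neg hb, if_pos hab]

/-- long ascents off column `0` are absent. -/
theorem sgn_longAsc (a b : Fin (n + 1)) (h : (b : ℕ) < (a : ℕ)) (hb : (b : ℕ) ≠ 0) (hab : (a : ℕ) ≠ (b : ℕ) + 1) :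
    sgn n a b = 0 := by
  unfold sgn
  rw [if_neg (fun hab => by rw [hab] at h; exact lt_irrefl _ h), if_pos h, if_neg hb, if_neg hab]

/-- unit descents are present with sign `+1`. -/
theorem sgn_unitDesc (a b : Fin (n + 1)) (h : (a : ℕ) < (b : ℕ)) (hab : (b : ℕ) = (a : ℕ) + 1) : sgn n a b = 1 := by
  unfold sgn
  rw [if_neg (fun hab => by rw [hab] at h; exact lt_irrefl _ h), if_neg (by omega), if_pos hab]

/-- long descents carry `lsign`. -/
theorem sgn_longDesc (a b : Fin (n + 1)) (h : (a : ℕ) < (b : ℕ)) (hab : (b : ℕ) ≠ (a : ℕ) + 1) :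
    sgn n a b = lsign n ((b : ℕ) - (a : ℕ)) ((a : ℕ) + 1) := by
  unfold sgn
  rw [if_neg (fun hab => by rw [hab] at h; exact lt_irrefl _ h), if_neg (by omega), if_neg hab]

/-- `(sign σ)² = 1` in `ℤ`. -/
theorem sign_sq (σ : Equiv.Perm (Fin (n + 1))) : ((Equiv.Perm.sign σ : ℤˣ) : ℤ) ^ 2 = 1 := by
  rcases Int.units_eq_one_or (Equiv.Perm.sign σ) with h | h <;> simp [h]

/-- `|sign σ| = 1`. -/
theorem natAbs_sign (σ : Equiv.Perm (Fin (n + 1))) : ((Equiv.Perm.sign σ : ℤˣ) : ℤ).natAbs = 1 := by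
  rcases Int.units_eq_one_or (Equiv.Perm.sign σ) with h | h <;> simp [h]

/-- `|csign z| = 1`. -/
theorem csign_natAbs (z : ℕ) : (csign n z).natAbs = 1 := by
  unfold csign
  rw [Int.natAbs_mul, Int.natAbs_pow, Int.natAbs_neg, Int.natAbs_one, one_pow, one_mul, natAbs_sign]

/-- `|lsign y z| = 1`. -/
theorem lsign_natAbs (y z : ℕ) : (lsign n y z).natAbs = 1 := by
  unfold lsign
  rw [Int.natAbs_mul, Int.natAbs_mul, Int.natAbs_pow, Int.natAbs_neg, Int.natAbs_one, one_pow, one_mul,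
    natAbs_sign, natAbs_sign]

/-- `csign z ≠ 0`. -/
theorem csign_ne_zero (z : ℕ) : csign n z ≠ 0 := by
  intro h; have := csign_natAbs n z; rw [h] at this; simp at this

/-- `lsign y z ≠ 0`. -/
theorem lsign_ne_zero (y z : ℕ) : lsign n y z ≠ 0 := by
  intro h; have := lsign_natAbs n y z; rw [h] at this; simp at this

/-- the design's signs lie in `{−1, 0, 1}` (`|ε| < 2`). -/
theorem ee_natAbs_lt_two (a b : Fin (n + 1)) (l : Fin 3) : (ee n a b l).natAbs < 2 := by
  unfold ee sgn
  split_ifs <;> simp [csign_natAbs, lsign_natAbs]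

/-- the design is STATIC: each entry carries at most one class. -/
theorem isStatic_ee : IsStatic (ee n) := by
  intro a b l l' h h'
  unfold ee at h h'
  by_contra hne
  by_cases hl : l = cls n a b
  · rw [hl] at hne
    exact h' (if_neg (Ne.symm hne))
  · exact h (if_neg hl)

/-- a present incidence carries the sign-rule class, with nonzero entry sign. -/
theorem cls_of_ee_ne_zero (a b : Fin (n + 1)) (l : Fin 3) (h : ee n a b l ≠ 0) : l = cls n a b ∧ sgn n a b ≠ 0 := by
  unfold ee at h
  by_cases hl : l = cls n a b
  · rw [if_pos hl] at h; exact ⟨hl, h⟩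
  · exact absurd (if_neg hl) h

/-- presence pattern: a lower entry off column `0` is a unit ascent. -/
theorem unitAsc_of_sgn_ne_zero (a b : Fin (n + 1)) (h : sgn n a b ≠ 0) (hlt : (b : ℕ) < (a : ℕ)) (hb : (b : ℕ) ≠ 0) :
    (a : ℕ) = (b : ℕ) + 1 := by
  by_contra hab
  exact h (sgn_longAsc n a b hlt hb hab)

/-- the value of the mountain permutation is given by `mf`. -/
theorem mtn_val {y z : ℕ} (h : 1 ≤ y ∧ 1 ≤ z ∧ y + z ≤ n + 1) (i : Fin (n + 1)) :
    ((mtn n y z i : Fin (n + 1)) : ℕ) = mf y z i := by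
  unfold mtn; rw [dif_pos h]; rfl

/-- `M_{0,0}` is the identity. -/
theorem mtn_zero_zero : mtn n 0 0 = 1 := by
  unfold mtn; rw [dif_neg (by omega)]

/-- `mf` at column `0`. -/
theorem mf_at0 (y z : ℕ) : mf y z 0 = z := by unfold mf; rw [if_pos rfl]

/-- `mf` on the descent block `[1, z)`. -/
theorem mf_desc (y z i : ℕ) (h1 : 1 ≤ i) (h2 : i < z) : mf y z i = i - 1 := by
  unfold mf; rw [if_neg (by omega), if_pos h2]

/-- `mf` on the ascent block `[z, z+y−1)`. -/
theorem mf_asc (y z i : ℕ) (h1 : z ≤ i) (h2 : i + 1 < z + y) (hz : 1 ≤ z) : mf y z i = i + 1 := by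
  unfold mf; rw [if_neg (by omega), if_neg (by omega), if_pos h2]

/-- `mf` at the top column `z+y−1`. -/
theorem mf_top (y z i : ℕ) (h : i + 1 = z + y) (hz : 1 ≤ z) (hy : 1 ≤ y) : mf y z i = z - 1 := by
  unfold mf; rw [if_neg (by omega), if_neg (by omega), if_neg (by omega), if_pos h]

/-- `mf` above the moved block. -/
theorem mf_fix (y z i : ℕ) (h : z + y ≤ i) (hz : 1 ≤ z) : mf y z i = i := by
  unfold mf; rw [if_neg (by omega), if_neg (by omega), if_neg (by omega), if_neg (by omega)]

/-- five-piece splitting of a sum over `range (n+1)` at `1, z, z+y−1, z+y`. -/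
theorem sum_split5 {M : Type*} [AddCommMonoid M] (f : ℕ → M) (y z : ℕ) (h : 1 ≤ y ∧ 1 ≤ z ∧ y + z ≤ n + 1) :
    ∑ i ∈ range (n + 1), f i =
      f 0 + ∑ i ∈ Ico 1 z, f i + ∑ i ∈ Ico z (z + y - 1), f i + f (z + y - 1) + ∑ i ∈ Ico (z + y) (n + 1), f i := by
  rw [Finset.range_eq_Ico]
  rw [← Finset.sum_Ico_consecutive f (show 0 ≤ z + y by omega) (show z + y ≤ n + 1 by omega),
    Finset.sum_eq_sum_Ico_succ_bot (show 0 < z + y by omega),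
    ← Finset.sum_Ico_consecutive f (show 0 + 1 ≤ z by omega) (show z ≤ z + y by omega)]
  have e1 : z + y = (z + y - 1) + 1 := by omega
  conv_lhs => rw [e1, Finset.sum_Ico_succ_top (show z ≤ z + y - 1 by omega)]
  rw [← e1, show (0 : ℕ) + 1 = 1 from rfl]
  abel

/-- the same for products. -/
theorem prod_split5 {M : Type*} [CommMonoid M] (f : ℕ → M) (y z : ℕ) (h : 1 ≤ y ∧ 1 ≤ z ∧ y + z ≤ n + 1) :
    ∏ i ∈ range (n + 1), f i =
      f 0 * (∏ i ∈ Ico 1 z, f i) * (∏ i ∈ Ico z (z + y - 1), f i) * f (z + y - 1) *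
        ∏ i ∈ Ico (z + y) (n + 1), f i := by
  rw [Finset.range_eq_Ico]
  rw [← Finset.prod_Ico_consecutive f (show 0 ≤ z + y by omega) (show z + y ≤ n + 1 by omega),
    Finset.prod_eq_prod_Ico_succ_bot (show 0 < z + y by omega),
    ← Finset.prod_Ico_consecutive f (show 0 + 1 ≤ z by omega) (show z ≤ z + y by omega)]
  have e1 : z + y = (z + y - 1) + 1 := by omega
  conv_lhs => rw [e1, Finset.prod_Ico_succ_top (show z ≤ z + y - 1 by omega)]
  rw [← e1, show (0 : ℕ) + 1 = 1 from rfl]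
  simp only [mul_assoc, mul_comm, mul_left_comm]

/-- geometric telescope: `∑_{a<t} Q^a (Q − 1) = Q^t − 1`. -/
theorem geom (t : ℕ) : ∑ a ∈ range t, Q n ^ a * (Q n - 1) = Q n ^ t - 1 := by
  induction t with
  | zero => simp
  | succ t ih => rw [Finset.sum_range_succ, ih, pow_succ]; ring

end Mountain

end Summit.ValiantsHypothesis.ValiantsHypothesis.Theorems.LacunarySymmetroidMatrixDescartes.TropicalCensus
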